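import Summits.Ventures.PercRepro0.ZhangSym
import Summits.Ventures.PercRepro0.RightCont
import Summits.Ventures.PercRepro0.HarrisCor

/-!
# P1 · HARRIS (Zhang's argument), part D2: the square-root trick and the assembly

Cell pub-perc-repro0, seat p2 (gen 2).  On parts A–D1 this file completes the PROBABILISTIC skeleton of
proofs/P1-harris-p1-v1.md §4–§6, leaving the combinatorial separation `ZhangSeparation` (P9 Lemma 4.1,
proved by p1) as its ONE hypothesis besides uniqueness:

* §4 the square-root trick with P7 in infinite volume (p3's `HarrisCor.one_sub_pow_le_of_isUpperSet` /
  `…_isLowerSet`; no truncation in `M` is needed): `P_p(E_n) > 1 − 8⁻⁴ ⇒ P_p(A^L_n) > 7/8`, and the same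
  for the dual arms through `P_half_dualBoxInf`;
* §5 `P_½(E_n) → 1` from L5 (`ZeroOne`) and `tendsto_P_boxInf`;
* §6 the assembly: `G_n = A^L ∩ A^R ∩ A*^{T*} ∩ A*^{B*}` has `P_½ > ½`; the box event
  `Z_n = {E_n^+ closed}` is a cylinder of positive probability (`RightCont.measureReal_cylS`) independent
  of `G_n` (F5, `P_inter_eq_mul_of_disjoint` on `F_{E_n^+}` / `F_{(E_n^+)ᶜ}`); uniqueness (P3) has full
  measure, so some `ω ∈ G_n ∩ Z_n ∩ U` exists, and Step 4 derives the four hypotheses of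
  `ZhangSeparation` for it (an open path inside a box `Λ_{N−1}` joins the two percolating side vertices,
  the dual arms reach `ψ(∂Λ*_N)`).

Main theorem: `P1_Harris_of (hsep : ZhangSeparation) (hP3 : P3_Unique 2) : P1_Harris`.
P7 (Harris–FKG) is kernel-checked (`Harris.P7_FKG_holds`), so it is no hypothesis.
-/

open MeasureTheory ProbabilityTheory unitInterval
open scoped ENNReal Topology

namespace Summit.Ventures.PercRepro0.Zhang

open Summit.Ventures.PercRepro0.Defs Summit.Ventures.PercRepro0.L2 Summit.Ventures.PercRepro0.DualMap
  Summit.Ventures.PercRepro0.Crossing Summit.Ventures.PercRepro0.Harris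

-- BEGIN BODY

open Summit.Ventures.PercRepro0.L2 Summit.Ventures.PercRepro0.DualMap Summit.Ventures.PercRepro0.Crossing
  Summit.Ventures.PercRepro0.Harris

/-! ### §4 The square-root trick (P1 Lemma 4.1), with P7 in infinite volume -/

/-- `E_n ⊆ ⋃_i A^{S_i}_n` over the four primal sides. -/
theorem boxInf_subset_iUnion_armPInf (n : ℕ) :
    boxInf n ⊆ ⋃ i ∈ (Finset.univ : Finset (Fin 4)), armPInf (pside n i) n := by
  intro ω hω
  rcases boxInf_subset_arms n hω with ((h | h) | h) | h
  · exact Set.mem_iUnion₂.2 ⟨0, Finset.mem_univ _, h⟩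
  · exact Set.mem_iUnion₂.2 ⟨1, Finset.mem_univ _, h⟩
  · exact Set.mem_iUnion₂.2 ⟨2, Finset.mem_univ _, h⟩
  · exact Set.mem_iUnion₂.2 ⟨3, Finset.mem_univ _, h⟩

/-- `E*_n ⊆ ⋃_i A*^{S*_i}_n` over the four dual sides. -/
theorem dualBoxInf_subset_iUnion_armDInf (n : ℕ) :
    dualBoxInf n ⊆ ⋃ i ∈ (Finset.univ : Finset (Fin 4)), armDInf (dside n i) n := by
  intro ω hω
  rcases dualBoxInf_subset_darms n hω with ((h | h) | h) | h
  · exact Set.mem_iUnion₂.2 ⟨0, Finset.mem_univ _, h⟩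
  · exact Set.mem_iUnion₂.2 ⟨1, Finset.mem_univ _, h⟩
  · exact Set.mem_iUnion₂.2 ⟨2, Finset.mem_univ _, h⟩
  · exact Set.mem_iUnion₂.2 ⟨3, Finset.mem_univ _, h⟩

/-- The fourth-root step: `(1 − q)⁴ < 8⁻⁴` gives `q > 7/8`. -/
theorem seven_eighths_lt_of_pow_four {q : ℝ} (h : (1 - q) ^ 4 < (1 / 8 : ℝ) ^ 4) :
    7 / 8 < q := by
  by_contra hcon
  push Not at hcon
  have : (1 / 8 : ℝ) ^ 4 ≤ (1 - q) ^ 4 := pow_le_pow_left₀ (by norm_num) (by linarith) 4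
  linarith

/-- Lemma 4.1(a): `P_p(E_n) > 1 − 8⁻⁴ ⇒ P_p(A^L_n) > 7/8`. -/
theorem P_real_armPInf_leftSide_gt (n : ℕ) (p : I)
    (hE : 1 - (1 / 8 : ℝ) ^ 4 < (P 2 p).real (boxInf n)) :
    7 / 8 < (P 2 p).real (armPInf (leftSide n) n) := by
  have key := one_sub_pow_le_of_isUpperSet p (Finset.univ : Finset (Fin 4))
    (fun i => armPInf (pside n i) n) (fun i _ => isUpperSet_armPInf _ _)
    (fun i _ => measurableSet_armPInf _ _) (q := (P 2 p).real (armPInf (leftSide n) n))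
    (fun i _ => by simp only [measureReal_def, P_armPInf_pside])
  rw [Finset.card_univ, Fintype.card_fin] at key
  have hsub : (P 2 p).real (boxInf n) ≤
      (P 2 p).real (⋃ i ∈ (Finset.univ : Finset (Fin 4)), armPInf (pside n i) n) :=
    measureReal_mono (boxInf_subset_iUnion_armPInf n) (measure_ne_top _ _)
  exact seven_eighths_lt_of_pow_four (by linarith)

/-- Lemma 4.1(b): `P_½(E*_n) > 1 − 8⁻⁴ ⇒ P_½(A*^{T*}_n) > 7/8`. -/
theorem P_real_armDInf_topDual_gt (n : ℕ)
    (hE : 1 - (1 / 8 : ℝ) ^ 4 < (P 2 (clamp (1 / 2))).real (dualBoxInf n)) :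
    7 / 8 < (P 2 (clamp (1 / 2))).real (armDInf (topDual n) n) := by
  have key := one_sub_pow_le_of_isLowerSet (clamp (1 / 2)) (Finset.univ : Finset (Fin 4))
    (fun i => armDInf (dside n i) n) (fun i _ => isLowerSet_armDInf _ _)
    (fun i _ => measurableSet_armDInf _ _)
    (q := (P 2 (clamp (1 / 2))).real (armDInf (topDual n) n))
    (fun i _ => by simp only [measureReal_def, P_half_armDInf_dside])
  rw [Finset.card_univ, Fintype.card_fin] at key
  have hsub : (P 2 (clamp (1 / 2))).real (dualBoxInf n) ≤
      (P 2 (clamp (1 / 2))).real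
        (⋃ i ∈ (Finset.univ : Finset (Fin 4)), armDInf (dside n i) n) :=
    measureReal_mono (dualBoxInf_subset_iUnion_armDInf n) (measure_ne_top _ _)
  exact seven_eighths_lt_of_pow_four (by linarith)

/-! ### §5 `P_p(E_n) → 1` when an infinite cluster exists a.s. -/

/-- If `P_p(∃ infinite cluster) = 1` then `P_p(E_n) > 1 − ε` eventually. -/
theorem eventually_P_real_boxInf (p : I) (h1 : P 2 p (existsInfCluster 2) = 1) {ε : ℝ}
    (hε : 0 < ε) : ∀ᶠ n in Filter.atTop, 1 - ε < (P 2 p).real (boxInf n) := by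
  have ht := tendsto_P_boxInf p
  rw [h1] at ht
  have ht' := (ENNReal.tendsto_toReal ENNReal.one_ne_top).comp ht
  rw [ENNReal.toReal_one] at ht'
  exact ((tendsto_order.1 ht').1 (1 - ε) (by linarith)).mono fun n hn => by
    simpa only [measureReal_def, Function.comp] using hn

/-- If `P_p(∃ infinite cluster) = 1` then `P_p(E_n') > 1 − ε` eventually (ψ-coordinates). -/
theorem eventually_P_real_dboxInf (p : I) (h1 : P 2 p (existsInfCluster 2) = 1) {ε : ℝ}
    (hε : 0 < ε) : ∀ᶠ n in Filter.atTop, 1 - ε < (P 2 p).real (dboxInf n) := by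
  have ht := tendsto_P_dboxInf p
  rw [h1] at ht
  have ht' := (ENNReal.tendsto_toReal ENNReal.one_ne_top).comp ht
  rw [ENNReal.toReal_one] at ht'
  exact ((tendsto_order.1 ht').1 (1 - ε) (by linarith)).mono fun n hn => by
    simpa only [measureReal_def, Function.comp] using hn

/-! ### §6 Step 1–3: the good event, the box event and their intersection -/

/-- `G_n = A^L_n ∩ A^R_n ∩ A*^{T*}_n ∩ A*^{B*}_n` (P1 §6 Step 1). -/
def goodEvent (n : ℕ) : Set (Config 2) :=
  armPInf (leftSide n) n ∩ armPInf (rightSide n) n ∩ armDInf (topDual n) n ∩ armDInf (botDual n) n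

/-- `G_n` is `F_{(E_n^+)ᶜ}`-measurable. -/
theorem measurableSet_sigmaOn_goodEvent (n : ℕ) :
    MeasurableSet[sigmaOn (boxPlusBonds n)ᶜ] (goodEvent n) :=
  (((measurableSet_armPInf_sigmaOn _ _).inter (measurableSet_armPInf_sigmaOn _ _)).inter
    (measurableSet_armDInf_sigmaOn _ _)).inter (measurableSet_armDInf_sigmaOn _ _)

/-- `G_n` is measurable. -/
theorem measurableSet_goodEvent (n : ℕ) : MeasurableSet (goodEvent n) :=
  (sigmaOn_le _) _ (measurableSet_sigmaOn_goodEvent n)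

/-- Step 1: four events of probability `> 7/8` intersect in probability `> 1/2`. -/
theorem P_real_goodEvent_gt (n : ℕ) (p : I)
    (hL : 7 / 8 < (P 2 p).real (armPInf (leftSide n) n))
    (hR : 7 / 8 < (P 2 p).real (armPInf (rightSide n) n))
    (hT : 7 / 8 < (P 2 p).real (armDInf (topDual n) n))
    (hB : 7 / 8 < (P 2 p).real (armDInf (botDual n) n)) :
    1 / 2 < (P 2 p).real (goodEvent n) := by
  have hc : (goodEvent n)ᶜ = (armPInf (leftSide n) n)ᶜ ∪ (armPInf (rightSide n) n)ᶜ ∪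
      (armDInf (topDual n) n)ᶜ ∪ (armDInf (botDual n) n)ᶜ := by
    simp only [goodEvent, Set.compl_inter]
  have h1 : (P 2 p).real (goodEvent n)ᶜ ≤ (P 2 p).real (armPInf (leftSide n) n)ᶜ +
      (P 2 p).real (armPInf (rightSide n) n)ᶜ + (P 2 p).real (armDInf (topDual n) n)ᶜ +
      (P 2 p).real (armDInf (botDual n) n)ᶜ := by
    rw [hc]
    have ha := measureReal_union_le (μ := P 2 p)
      ((armPInf (leftSide n) n)ᶜ ∪ (armPInf (rightSide n) n)ᶜ ∪ (armDInf (topDual n) n)ᶜ)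
      (armDInf (botDual n) n)ᶜ
    have hb := measureReal_union_le (μ := P 2 p)
      ((armPInf (leftSide n) n)ᶜ ∪ (armPInf (rightSide n) n)ᶜ) (armDInf (topDual n) n)ᶜ
    have hc' := measureReal_union_le (μ := P 2 p) (armPInf (leftSide n) n)ᶜ (armPInf (rightSide n) n)ᶜ
    linarith
  rw [probReal_compl_eq_one_sub (measurableSet_goodEvent n),
    probReal_compl_eq_one_sub (measurableSet_armPInf _ _),
    probReal_compl_eq_one_sub (measurableSet_armPInf _ _),
    probReal_compl_eq_one_sub (measurableSet_armDInf _ _),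
    probReal_compl_eq_one_sub (measurableSet_armDInf _ _)] at h1
  linarith

/-- A bond with an endpoint in `Λ_n` lies inside `Λ_{n+1}`. -/
theorem boxPlusBonds_subset_boxBonds (n : ℕ) : boxPlusBonds n ⊆ boxBonds 2 (n + 1) := by
  rintro e ⟨he, v, hv, hvb⟩
  refine ⟨he, fun w hw => ?_⟩
  have hvn : nrm v ≤ n := mem_box_iff.1 hvb
  induction e using Sym2.ind with
  | h x y =>
    have hadj : (lattice 2).Adj x y := (SimpleGraph.mem_edgeSet (lattice 2)).1 he
    rcases Sym2.mem_iff.1 hv with rfl | rfl <;> rcases Sym2.mem_iff.1 hw with rfl | rfl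
    · omega
    · have := nrm_le_of_adj hadj; omega
    · have := nrm_le_of_adj hadj.symm; omega
    · omega

/-- `E_n^+` is finite. -/
theorem finite_boxPlusBonds (n : ℕ) : (boxPlusBonds n).Finite :=
  (finite_boxBonds (n + 1)).subset (boxPlusBonds_subset_boxBonds n)

/-- The box event `Z_n`: every bond of `E_n^+` is closed (P1 §6 Step 2). -/
def boxClosed (n : ℕ) : Set (Config 2) := {ω | ∀ e ∈ boxPlusBonds n, e ∉ ω}

/-- `Z_n` is the cylinder event «all bonds of `E_n^+` closed». -/
theorem boxClosed_eq_cylS (n : ℕ) :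
    boxClosed n = cylS (finite_boxPlusBonds n).toFinset (fun _ => false) := by
  ext ω
  simp only [boxClosed, Set.mem_setOf_eq, mem_cylS, Bool.false_eq_true, iff_false]
  constructor
  · intro h e
    exact h e ((finite_boxPlusBonds n).mem_toFinset.1 e.2)
  · intro h e he
    exact h ⟨e, (finite_boxPlusBonds n).mem_toFinset.2 he⟩

/-- `Z_n` is `F_{E_n^+}`-measurable. -/
theorem measurableSet_sigmaOn_boxClosed (n : ℕ) :
    MeasurableSet[sigmaOn (boxPlusBonds n)] (boxClosed n) := by
  have : boxClosed n = ⋂ e ∈ boxPlusBonds n, {ω : Config 2 | e ∈ ω}ᶜ := by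
    ext ω; simp [boxClosed]
  rw [this]
  exact MeasurableSet.biInter (Set.to_countable _) fun e he =>
    (measurableSet_sigmaOn_mem (E := boxPlusBonds n) he).compl

/-- `P_½(Z_n) > 0`: a cylinder on finitely many bonds (`P_½(Z_n) = 2^{−|E_n^+|}`). -/
theorem P_half_boxClosed_ne_zero (n : ℕ) : P 2 (clamp (1 / 2)) (boxClosed n) ≠ 0 := by
  rw [boxClosed_eq_cylS]
  intro h0
  have hreal := measureReal_cylS (finite_boxPlusBonds n).toFinset
    (fun e he => ((finite_boxPlusBonds n).mem_toFinset.1 he).1) (fun _ => false) (clamp (1 / 2))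
  rw [h0, ENNReal.toReal_zero] at hreal
  have hpos : (0 : ℝ) < ∏ e : (finite_boxPlusBonds n).toFinset,
      (if (fun _ => false) e then ((clamp (1 / 2) : I) : ℝ) else 1 - (clamp (1 / 2) : I)) := by
    refine Finset.prod_pos fun e _ => ?_
    simp only [Bool.false_eq_true, if_false, PlanarT2.coe_clamp_half]
    norm_num
  linarith

/-- Step 2 (F5): `G_n` and `Z_n` are independent. -/
theorem P_goodEvent_inter_boxClosed (n : ℕ) (p : I) :
    P 2 p (goodEvent n ∩ boxClosed n) = P 2 p (goodEvent n) * P 2 p (boxClosed n) :=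
  P_inter_eq_mul_of_disjoint p disjoint_compl_left (measurableSet_sigmaOn_goodEvent n)
    (measurableSet_sigmaOn_boxClosed n)

/-! ### §6 Step 4: from a configuration of `G_n ∩ Z_n ∩ U` to the hypotheses of `ZhangSeparation` -/

/-- `InAdj` is monotone in the box size. -/
theorem inAdj_mono {K K' : ℕ} (h : K ≤ K') {ω : Config 2} {x y : Vertex 2} (hxy : InAdj K ω x y) :
    InAdj K' ω x y :=
  ⟨hxy.1, hxy.2.1, fun i => (hxy.2.2.1 i).trans (by exact_mod_cast h),
    fun i => (hxy.2.2.2 i).trans (by exact_mod_cast h)⟩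

/-- An open path lies inside some box `Λ_K`. -/
theorem exists_inAdj_of_conn {ω : Config 2} {x y : Vertex 2} (h : Conn 2 ω x y) :
    ∃ K : ℕ, Relation.ReflTransGen (InAdj K ω) x y := by
  rw [conn_iff_reflTransGen] at h
  induction h with
  | refl => exact ⟨0, Relation.ReflTransGen.refl⟩
  | @tail b c _ hbc ih =>
    obtain ⟨K, hK⟩ := ih
    refine ⟨max K (max (nrm b) (nrm c)), ?_⟩
    refine (reflTransGen_mono (fun _ _ hab => inAdj_mono (le_max_left _ _) hab) hK).tail ?_
    exact ⟨hbc.1, hbc.2, mem_box_iff.2 (le_max_of_le_right (le_max_left _ _)),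
      mem_box_iff.2 (le_max_of_le_right (le_max_right _ _))⟩

/-- `L_n` is finite. -/
theorem finite_leftSide (n : ℕ) : (leftSide n).Finite :=
  (finite_box (n + 1)).subset fun _ hu => (nrm_eq_of_mem_leftSide hu).le

/-- `R_n` is finite. -/
theorem finite_rightSide (n : ℕ) : (rightSide n).Finite :=
  (finite_box (n + 1)).subset fun _ hu => (nrm_eq_of_mem_rightSide hu).le

/-- Step 4: a configuration of `G_n ∩ Z_n ∩ U` contradicts `ZhangSeparation` (`n ≥ 1`). -/
theorem false_of_mem_goodEvent (hsep : ZhangSeparation) {n : ℕ} (hn : 1 ≤ n) {ω : Config 2}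
    (hG : ω ∈ goodEvent n) (hZ : ω ∈ boxClosed n) (hU : ω ∈ atMostOneInfCluster 2) : False := by
  obtain ⟨⟨⟨hL, hR⟩, hT⟩, hB⟩ := hG
  obtain ⟨vL, hvL, hvLinf⟩ := exists_connInf_of_armPInf (finite_leftSide n) hL
  obtain ⟨vR, hvR, hvRinf⟩ := exists_connInf_of_armPInf (finite_rightSide n) hR
  have hconn : Conn 2 ω vL vR := hU vL vR hvLinf hvRinf
  obtain ⟨K, hK⟩ := exists_inAdj_of_conn hconn
  have hN : n + 2 ≤ max (n + 2) (K + 1) := le_max_left _ _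
  have hKN : K ≤ max (n + 2) (K + 1) - 1 := by omega
  refine hsep n (max (n + 2) (K + 1)) ω hn hN hZ
    ⟨vL, hvL, vR, hvR, reflTransGen_mono (fun _ _ hab => inAdj_mono hKN hab) hK⟩ ?_ ?_
  · exact mem_armD.1 (Set.mem_iInter₂.1 hT _ hN)
  · exact mem_armD.1 (Set.mem_iInter₂.1 hB _ hN)

/-! ### The theorem -/

/-- **P1 · HARRIS, probabilistic skeleton**: `θ_2(½) = 0`, given the combinatorial separation
`ZhangSeparation` (P9 Lemma 4.1, p1) and uniqueness `P3_Unique 2` (p6).  Everything else —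
L5 (`ZeroOne`), F1/F2 (`Events`, `Aut`), F5 (`Independence`), P7 (`Harris`), the self-duality at `½`
(`DualMap`) — is kernel-checked. -/
theorem P1_Harris_of (hsep : ZhangSeparation) (hP3 : P3_Unique 2) : P1_Harris := by
  show thetaI 2 (clamp (1 / 2)) = 0
  by_contra hne
  have hpos : 0 < thetaI 2 (clamp (1 / 2)) := lt_of_le_of_ne (thetaI_nonneg _ _) (Ne.symm hne)
  have h1 : P 2 (clamp (1 / 2)) (existsInfCluster 2) = 1 :=
    measure_existsInfCluster_eq_one_of_thetaI_pos _ hpos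
  -- Step 1: choose `n`
  obtain ⟨n, hEn, hEn', hn1⟩ := ((eventually_P_real_boxInf _ h1 (ε := (1 / 8 : ℝ) ^ 4) (by norm_num)).and
    ((eventually_P_real_dboxInf _ h1 (ε := (1 / 8 : ℝ) ^ 4) (by norm_num)).and
      (Filter.eventually_ge_atTop 1))).exists
  have hEdual : 1 - (1 / 8 : ℝ) ^ 4 < (P 2 (clamp (1 / 2))).real (dualBoxInf n) := by
    rwa [measureReal_def, P_half_dualBoxInf, ← measureReal_def]
  have hL := P_real_armPInf_leftSide_gt n _ hEn
  have hR : 7 / 8 < (P 2 (clamp (1 / 2))).real (armPInf (rightSide n) n) := by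
    rwa [measureReal_def, P_armPInf_rightSide, ← measureReal_def]
  have hT := P_real_armDInf_topDual_gt n hEdual
  have hB : 7 / 8 < (P 2 (clamp (1 / 2))).real (armDInf (botDual n) n) := by
    rwa [measureReal_def, P_half_armDInf_botDual, ← measureReal_def]
  have hG := P_real_goodEvent_gt n _ hL hR hT hB
  have hGne : P 2 (clamp (1 / 2)) (goodEvent n) ≠ 0 := by
    intro h0
    rw [measureReal_def, h0, ENNReal.toReal_zero] at hG
    linarith
  -- Step 2: independence
  have hGZ : P 2 (clamp (1 / 2)) (goodEvent n ∩ boxClosed n) ≠ 0 := by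
    rw [P_goodEvent_inter_boxClosed]
    exact mul_ne_zero hGne (P_half_boxClosed_ne_zero n)
  -- Step 3: uniqueness has full measure
  have hUc : P 2 (clamp (1 / 2)) (atMostOneInfCluster 2)ᶜ = 0 :=
    (prob_compl_eq_zero_iff Defs.measurableSet_atMostOneInfCluster).2 (hP3 _)
  have hGZU : P 2 (clamp (1 / 2)) (goodEvent n ∩ boxClosed n ∩ atMostOneInfCluster 2) ≠ 0 := by
    intro h0
    apply hGZ
    refine le_antisymm ?_ zero_le
    calc P 2 (clamp (1 / 2)) (goodEvent n ∩ boxClosed n)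
        ≤ P 2 (clamp (1 / 2)) (goodEvent n ∩ boxClosed n ∩ atMostOneInfCluster 2) +
          P 2 (clamp (1 / 2)) ((goodEvent n ∩ boxClosed n) \ atMostOneInfCluster 2) :=
          measure_le_inter_add_sdiff _ _ _
      _ ≤ 0 + P 2 (clamp (1 / 2)) (atMostOneInfCluster 2)ᶜ :=
          add_le_add h0.le (measure_mono fun _ hx => hx.2)
      _ = 0 := by rw [hUc, zero_add]
  -- Step 4
  obtain ⟨ω, ⟨hωG, hωZ⟩, hωU⟩ := nonempty_of_measure_ne_zero hGZU
  exact false_of_mem_goodEvent hsep hn1 hωG hωZ hωU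


-- END BODY

end Summit.Ventures.PercRepro0.Zhang
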